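import Literature.Computability.Complexity.OneInThreeSAT
import HarnessLib

/-!
# The clause gadget `3SAT → ONE-IN-THREE 3SAT` (Schaefer 1978; Garey–Johnson [LO4]):
the combinatorial half of the discharge of `Schaefer1978_oneInThreeSAT_NPHard`

Garey–Johnson [LO4] (p. 259): ONE-IN-THREE 3SAT is NP-complete, "Transformation from 3SAT"
(Schaefer 1978). This file proves the formula-level correctness of the classical transformation;
the machine half (the map on `encodingCNF`-codes is in `FP`, with the canonical-code / width
guards of `KSATReductions.lean`) and the assembly `kSAT 3 ≤ₚ ONEIN3SAT`, hence
`Schaefer1978_oneInThreeSAT_NPHard` from `isNPComplete_kSAT_three_holds`, are the planned sequel.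

**The transformation** (folklore form of Schaefer's reduction, e.g. as taught for [LO4]). A clause
of width `≤ 3` is first padded to three literal slots `(ℓ₁, ℓ₂, ℓ₃)` by repeating its last literal
(`pad3`; `ℓ₁ ∨ ℓ₂ ∨ ℓ₃` is equivalent to the clause, `pad3_or_eq_eval`). With four fresh variables
`t, t+1, t+2, t+3` it is replaced by the three one-in-three clauses

  `R(¬ℓ₁, t, t+1)`, `R(ℓ₂, t+1, t+2)`, `R(¬ℓ₃, t+2, t+3)`            (`gadget`)

(`R(p,q,r)` = "exactly one of `p, q, r` is true"); the `i`-th clause of the input uses the block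
`t = B + 4 i` above a bound `B` on the input's variables (`clauseGadget`, `reduce`). An empty input
clause (an unsatisfiable input) is sent to the one-in-three-unsatisfiable pair
`R(t, t+1, t+2), R(¬t, t+1, t+2)` (`unsatGadget`, padded by a repeated clause to three clauses, so
that every input clause yields exactly three output clauses, `length_clauseGadget`).

**Proved.**
* the truth tables: soundness `R(¬x,a,b) ∧ R(y,b,c) ∧ R(¬z,c,d) → x ∨ y ∨ z` (`table_sound`) and
  completeness with the explicit fresh values `a = x ∧ y`, `b = x ∧ ¬y`, `c = ¬x ∧ ¬y`,
  `d = z ∧ (x ∨ y)` (`vals`, `table_complete`); `unsatGadget` is never one-in-three satisfied;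
* `isThreeLiteralClauses_reduce`: every output clause has three pairwise distinct literals
  (freshness `B >` all input variables);
* `xSatisfiable_reduce_iff`: for a CNF of width `≤ 3` with variables `< B`,
  **`(reduce B φ).XSatisfiable ↔ φ.Satisfiable`** — from a one-in-three assignment by restriction
  (`satisfiable_of_xSatisfiable_reduce`), and conversely by the extension `extend B σ φ` which
  gives the fresh block of clause `i` the values `vals` computed from `σ` on its three slots
  (`xSatisfiable_reduce_of_satisfiable`).

## References

* [GareyJohnson1979] M. R. Garey, D. S. Johnson, *Computers and Intractability* (1979), [LO4]
  ONE-IN-THREE 3SAT, p. 259 ("Transformation from 3SAT").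
* [Schaefer1978] T. J. Schaefer, *The complexity of satisfiability problems*, STOC 1978.
-/

namespace Literature.Computability.Complexity

namespace OneInThree

universe u

variable {ν : Type u}

/-! ### Exactly one of three -/

/-- `exactlyOne p q r`: exactly one of three Booleans is true. [folklore] -/
def exactlyOne (p q r : Bool) : Bool :=
  (p && !q && !r) || (!p && q && !r) || (!p && !q && r)

/-- The one-in-three value of a three-literal clause is `exactlyOne` of the literal values.
[cite: GareyJohnson1979, LO4 (p. 259)] -/
theorem xeval_triple (σ : ν → Bool) (l₁ l₂ l₃ : Literal ν) :
    Clause.xeval σ [l₁, l₂, l₃] = exactlyOne (l₁.eval σ) (l₂.eval σ) (l₃.eval σ) := by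
  unfold Clause.xeval exactlyOne
  cases h₁ : l₁.eval σ <;> cases h₂ : l₂.eval σ <;> cases h₃ : l₃.eval σ <;>
    simp [List.countP_nil, h₁, h₂, h₃]

/-- A positive literal evaluates to the value of its variable. [folklore] -/
theorem eval_pos (σ : ν → Bool) (v : ν) : Literal.eval σ (v, true) = σ v := by
  unfold Literal.eval; cases σ v <;> rfl

/-- A negative literal evaluates to the negated value of its variable. [folklore] -/
theorem eval_neg (σ : ν → Bool) (v : ν) : Literal.eval σ (v, false) = !σ v := by
  unfold Literal.eval; cases σ v <;> rfl

/-- **Soundness table** of the gadget: `R(¬x,a,b)`, `R(y,b,c)`, `R(¬z,c,d)` force `x ∨ y ∨ z`.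
[folklore] -/
theorem table_sound : ∀ x y z a b c d : Bool,
    exactlyOne (!x) a b = true → exactlyOne y b c = true → exactlyOne (!z) c d = true →
      (x || y || z) = true := by
  decide

/-- The explicit fresh values of the gadget for literal values `x, y, z`:
`a = x ∧ y`, `b = x ∧ ¬y`, `c = ¬x ∧ ¬y`, `d = z ∧ (x ∨ y)` (slots `0,1,2,3`; `false` beyond).
[folklore] -/
def vals (x y z : Bool) : ℕ → Bool
  | 0 => x && y
  | 1 => x && !y
  | 2 => !x && !y
  | 3 => z && (x || y)
  | _ => false

/-- **Completeness table** of the gadget: if `x ∨ y ∨ z` then the fresh values `vals` make all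
three one-in-three clauses true. [folklore] -/
theorem table_complete : ∀ x y z : Bool, (x || y || z) = true →
    exactlyOne (!x) (vals x y z 0) (vals x y z 1) = true ∧
      exactlyOne y (vals x y z 1) (vals x y z 2) = true ∧
        exactlyOne (!z) (vals x y z 2) (vals x y z 3) = true := by
  decide

/-- The pair `R(a,b,c)`, `R(¬a,b,c)` is never one-in-three satisfied. [folklore] -/
theorem table_unsat : ∀ a b c : Bool, ¬ (exactlyOne a b c = true ∧ exactlyOne (!a) b c = true) := by
  decide

/-! ### Padding a clause of width `≤ 3` to three slots -/

/-- Pad a clause to three literal slots by repeating its last literal; `none` for the empty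
clause (literals beyond the third are dropped — they do not occur for width `≤ 3`). [folklore] -/
def pad3 : Clause ν → Option (Literal ν × Literal ν × Literal ν)
  | [] => none
  | [l] => some (l, l, l)
  | [l₁, l₂] => some (l₁, l₂, l₂)
  | l₁ :: l₂ :: l₃ :: _ => some (l₁, l₂, l₃)

/-- For a clause of width `≤ 3`, the disjunction of the three slots is the value of the clause.
[folklore] -/
theorem pad3_or_eq_eval (σ : ν → Bool) {c : Clause ν} (hc : c.length ≤ 3)
    {l₁ l₂ l₃ : Literal ν} (h : pad3 c = some (l₁, l₂, l₃)) :
    (l₁.eval σ || l₂.eval σ || l₃.eval σ) = Clause.eval σ c := by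
  match c, hc, h with
  | [l], _, h =>
    simp only [pad3, Option.some.injEq, Prod.mk.injEq] at h
    obtain ⟨rfl, rfl, rfl⟩ := h
    simp [Clause.eval]
  | [m₁, m₂], _, h =>
    simp only [pad3, Option.some.injEq, Prod.mk.injEq] at h
    obtain ⟨rfl, rfl, rfl⟩ := h
    simp [Clause.eval]
  | [m₁, m₂, m₃], _, h =>
    simp only [pad3, Option.some.injEq, Prod.mk.injEq] at h
    obtain ⟨rfl, rfl, rfl⟩ := h
    simp [Clause.eval, Bool.or_assoc]
  | _ :: _ :: _ :: _ :: t, hc, _ =>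
    exfalso
    simp only [List.length_cons] at hc
    omega

/-- The three slots are literals of the clause. [folklore] -/
theorem mem_of_pad3 {c : Clause ν} {l₁ l₂ l₃ : Literal ν} (h : pad3 c = some (l₁, l₂, l₃)) :
    l₁ ∈ c ∧ l₂ ∈ c ∧ l₃ ∈ c := by
  match c, h with
  | [l], h =>
    simp only [pad3, Option.some.injEq, Prod.mk.injEq] at h
    obtain ⟨rfl, rfl, rfl⟩ := h; simp
  | [m₁, m₂], h =>
    simp only [pad3, Option.some.injEq, Prod.mk.injEq] at h
    obtain ⟨rfl, rfl, rfl⟩ := h; simp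
  | m₁ :: m₂ :: m₃ :: _, h =>
    simp only [pad3, Option.some.injEq, Prod.mk.injEq] at h
    obtain ⟨rfl, rfl, rfl⟩ := h; simp

/-- `pad3 c = none` only for the empty clause. [folklore] -/
theorem eq_nil_of_pad3_eq_none {c : Clause ν} (h : pad3 c = none) : c = [] := by
  match c, h with
  | [], _ => rfl
  | [l], h => simp [pad3] at h
  | [m₁, m₂], h => simp [pad3] at h
  | _ :: _ :: _ :: _, h => simp [pad3] at h

/-! ### The gadgets and the transformation -/

/-- The gadget of one padded clause with fresh block `t`: `R(¬ℓ₁, t, t+1)`, `R(ℓ₂, t+1, t+2)`,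
`R(¬ℓ₃, t+2, t+3)` (fresh variables occur positively). [cite: GareyJohnson1979, LO4 (p. 259)] -/
def gadget (l₁ l₂ l₃ : Literal ℕ) (t : ℕ) : CNF ℕ :=
  [[l₁.negate, (t, true), (t + 1, true)], [l₂, (t + 1, true), (t + 2, true)],
    [l₃.negate, (t + 2, true), (t + 3, true)]]

/-- A fixed one-in-three-unsatisfiable gadget on the fresh block `t`: `R(t, t+1, t+2)`,
`R(¬t, t+1, t+2)` (the image of an empty clause), padded with a repetition of the first clause so
that EVERY input clause yields exactly three output clauses (which keeps the clause count of the
machine half uniform). [folklore] -/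
def unsatGadget (t : ℕ) : CNF ℕ :=
  [[(t, true), (t + 1, true), (t + 2, true)], [(t, false), (t + 1, true), (t + 2, true)],
    [(t, true), (t + 1, true), (t + 2, true)]]

/-- Every clause gadget consists of exactly three clauses. [folklore] -/
theorem length_unsatGadget (t : ℕ) : (unsatGadget t).length = 3 := rfl

/-- The image of the `i`-th input clause: its gadget on the fresh block `B + 4 i` (or the
unsatisfiable pair if the clause is empty). [cite: GareyJohnson1979, LO4 (p. 259)] -/
def clauseGadget (B i : ℕ) (c : Clause ℕ) : CNF ℕ :=
  match pad3 c with
  | none => unsatGadget (B + 4 * i)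
  | some (l₁, l₂, l₃) => gadget l₁ l₂ l₃ (B + 4 * i)

/-- Every clause gadget consists of exactly three clauses. [folklore] -/
theorem length_clauseGadget (B i : ℕ) (c : Clause ℕ) : (clauseGadget B i c).length = 3 := by
  unfold clauseGadget
  match pad3 c with
  | none => rfl
  | some (l₁, l₂, l₃) => rfl

/-- The transformation of a clause list, clauses numbered from `i`. [cite: GareyJohnson1979, LO4 (p. 259)] -/
def reduceFrom (B : ℕ) : ℕ → CNF ℕ → CNF ℕ
  | _, [] => []
  | i, c :: φ => clauseGadget B i c ++ reduceFrom B (i + 1) φ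

/-- **The transformation `3SAT → ONE-IN-THREE 3SAT`** with fresh variables from `B` on.
[cite: GareyJohnson1979, LO4 (p. 259)] -/
def reduce (B : ℕ) (φ : CNF ℕ) : CNF ℕ :=
  reduceFrom B 0 φ

/-! ### Clause-wise description of the output -/

/-- One-in-three value of a concatenation. [folklore] -/
theorem xeval_append (φ ψ : CNF ν) (σ : ν → Bool) :
    CNF.xeval (φ ++ ψ) σ = (φ.xeval σ && ψ.xeval σ) := by
  simp [CNF.xeval, List.all_append]

/-- The output is one-in-three satisfied by `σ` iff every clause gadget is. [folklore] -/
theorem xeval_reduceFrom_iff (B : ℕ) (σ : ℕ → Bool) :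
    ∀ (i : ℕ) (ψ : CNF ℕ), (reduceFrom B i ψ).xeval σ = true ↔
      ∀ k (hk : k < ψ.length), (clauseGadget B (i + k) (ψ[k]'hk)).xeval σ = true
  | i, [] => by simp [reduceFrom, CNF.xeval]
  | i, c :: ψ => by
    rw [reduceFrom, xeval_append, Bool.and_eq_true, xeval_reduceFrom_iff B σ (i + 1) ψ]
    constructor
    · rintro ⟨hc, hψ⟩ k hk
      match k, hk with
      | 0, _ => simpa only [List.getElem_cons_zero, Nat.add_zero] using hc
      | k + 1, hk =>
        have h := hψ k (by simpa using hk)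
        have e : i + (k + 1) = i + 1 + k := by omega
        rw [e]
        simpa only [List.getElem_cons_succ] using h
    · intro h
      refine ⟨?_, fun k hk => ?_⟩
      · exact h 0 (by simp)
      · have h' := h (k + 1) (by simpa using hk)
        have e : i + (k + 1) = i + 1 + k := by omega
        rw [e] at h'
        simpa only [List.getElem_cons_succ] using h'

/-- Membership in the output: a clause of some clause gadget. [folklore] -/
theorem mem_reduceFrom_iff (B : ℕ) {d : Clause ℕ} :
    ∀ (i : ℕ) (ψ : CNF ℕ), d ∈ reduceFrom B i ψ ↔
      ∃ k, ∃ hk : k < ψ.length, d ∈ clauseGadget B (i + k) (ψ[k]'hk)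
  | i, [] => by simp [reduceFrom]
  | i, c :: ψ => by
    rw [reduceFrom, List.mem_append, mem_reduceFrom_iff B (i + 1) ψ]
    constructor
    · rintro (h | ⟨k, hk, h⟩)
      · exact ⟨0, by simp, by simpa only [List.getElem_cons_zero, Nat.add_zero] using h⟩
      · refine ⟨k + 1, by simpa using hk, ?_⟩
        have e : i + (k + 1) = i + 1 + k := by omega
        rw [e]
        simpa only [List.getElem_cons_succ] using h
    · rintro ⟨k, hk, h⟩
      match k, hk, h with
      | 0, _, h => exact Or.inl (by simpa only [List.getElem_cons_zero, Nat.add_zero] using h)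
      | k + 1, hk, h =>
        refine Or.inr ⟨k, by simpa using hk, ?_⟩
        have e : i + (k + 1) = i + 1 + k := by omega
        rw [e] at h
        simpa only [List.getElem_cons_succ] using h

/-! ### Every output clause has three pairwise distinct literals -/

/-- Literals with different variables are different. [folklore] -/
theorem lit_ne_of_fst_ne {a b : Literal ℕ} (h : a.1 ≠ b.1) : a ≠ b :=
  fun e => h (congrArg Prod.fst e)

/-- A three-element list of pairwise distinct literals has no duplicates. [folklore] -/
theorem nodup_triple {a b c : Literal ℕ} (hab : a ≠ b) (hac : a ≠ c) (hbc : b ≠ c) :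
    [a, b, c].Nodup := by
  simp [hab, hac, hbc]

/-- The clauses of a gadget have three pairwise distinct literals when the block lies above the
variables of the slots. [folklore] -/
theorem threeLiteral_of_mem_gadget {l₁ l₂ l₃ : Literal ℕ} {t : ℕ} (h₁ : l₁.1 < t) (h₂ : l₂.1 < t)
    (h₃ : l₃.1 < t) {d : Clause ℕ} (hd : d ∈ gadget l₁ l₂ l₃ t) : d.length = 3 ∧ d.Nodup := by
  simp only [gadget, List.mem_cons, List.not_mem_nil, or_false] at hd
  have n₁ : (l₁.negate).1 = l₁.1 := rfl
  have n₃ : (l₃.negate).1 = l₃.1 := rfl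
  rcases hd with rfl | rfl | rfl
  · exact ⟨rfl, nodup_triple (lit_ne_of_fst_ne (by rw [n₁]; simp; omega))
      (lit_ne_of_fst_ne (by rw [n₁]; simp; omega)) (lit_ne_of_fst_ne (by simp))⟩
  · exact ⟨rfl, nodup_triple (lit_ne_of_fst_ne (by simp; omega))
      (lit_ne_of_fst_ne (by simp; omega)) (lit_ne_of_fst_ne (by simp))⟩
  · exact ⟨rfl, nodup_triple (lit_ne_of_fst_ne (by rw [n₃]; simp; omega))
      (lit_ne_of_fst_ne (by rw [n₃]; simp; omega)) (lit_ne_of_fst_ne (by simp))⟩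

/-- The clauses of the unsatisfiable pair have three pairwise distinct literals. [folklore] -/
theorem threeLiteral_of_mem_unsatGadget {t : ℕ} {d : Clause ℕ} (hd : d ∈ unsatGadget t) :
    d.length = 3 ∧ d.Nodup := by
  simp only [unsatGadget, List.mem_cons, List.not_mem_nil, or_false] at hd
  rcases hd with rfl | rfl | rfl
  · exact ⟨rfl, nodup_triple (lit_ne_of_fst_ne (by simp)) (lit_ne_of_fst_ne (by simp))
      (lit_ne_of_fst_ne (by simp))⟩
  · exact ⟨rfl, nodup_triple (lit_ne_of_fst_ne (by simp)) (lit_ne_of_fst_ne (by simp))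
      (lit_ne_of_fst_ne (by simp))⟩
  · exact ⟨rfl, nodup_triple (lit_ne_of_fst_ne (by simp)) (lit_ne_of_fst_ne (by simp))
      (lit_ne_of_fst_ne (by simp))⟩

/-- The clauses of a clause gadget have three pairwise distinct literals when `B` lies above the
variables of the clause. [folklore] -/
theorem threeLiteral_of_mem_clauseGadget {B i : ℕ} {c : Clause ℕ} (hB : ∀ l ∈ c, l.1 < B)
    {d : Clause ℕ} (hd : d ∈ clauseGadget B i c) : d.length = 3 ∧ d.Nodup := by
  unfold clauseGadget at hd
  match hp : pad3 c with
  | none =>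
    rw [hp] at hd
    exact threeLiteral_of_mem_unsatGadget hd
  | some (l₁, l₂, l₃) =>
    rw [hp] at hd
    obtain ⟨m₁, m₂, m₃⟩ := mem_of_pad3 hp
    have hB' : ∀ l ∈ c, l.1 < B + 4 * i := fun l hl => Nat.lt_of_lt_of_le (hB l hl) (Nat.le_add_right _ _)
    exact threeLiteral_of_mem_gadget (hB' _ m₁) (hB' _ m₂) (hB' _ m₃) hd

/-- **Every clause of `reduce B φ` consists of three pairwise distinct literals**, provided `B`
lies above all variables of `φ`. [cite: GareyJohnson1979, LO4 (p. 259)] -/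
theorem isThreeLiteralClauses_reduce {B : ℕ} {φ : CNF ℕ} (hB : ∀ c ∈ φ, ∀ l ∈ c, l.1 < B) :
    (reduce B φ).IsThreeLiteralClauses := by
  intro d hd
  obtain ⟨k, hk, hd⟩ := (mem_reduceFrom_iff B 0 φ).1 hd
  exact threeLiteral_of_mem_clauseGadget (hB _ (List.getElem_mem hk)) hd

/-! ### From a one-in-three assignment of the output to a satisfying assignment of the input -/

/-- A one-in-three assignment of a clause gadget satisfies the (width `≤ 3`) input clause.
[folklore] -/
theorem eval_of_xeval_clauseGadget {B i : ℕ} {c : Clause ℕ} (hc : c.length ≤ 3) {σ : ℕ → Bool}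
    (h : (clauseGadget B i c).xeval σ = true) : Clause.eval σ c = true := by
  unfold clauseGadget at h
  match hp : pad3 c with
  | none =>
    rw [hp] at h
    exfalso
    have h' : Clause.xeval σ [(B + 4 * i, true), (B + 4 * i + 1, true), (B + 4 * i + 2, true)] = true ∧
        Clause.xeval σ [(B + 4 * i, false), (B + 4 * i + 1, true), (B + 4 * i + 2, true)] = true := by
      have h3 : (unsatGadget (B + 4 * i)).xeval σ = true := h
      simp only [unsatGadget, CNF.xeval, List.all_cons, List.all_nil, Bool.and_true,
        Bool.and_eq_true] at h3
      exact ⟨h3.1, h3.2.1⟩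
    rw [xeval_triple, xeval_triple, eval_pos, eval_pos, eval_pos, eval_neg] at h'
    exact table_unsat _ _ _ h'
  | some (l₁, l₂, l₃) =>
    rw [hp] at h
    have h' : Clause.xeval σ [l₁.negate, (B + 4 * i, true), (B + 4 * i + 1, true)] = true ∧
        Clause.xeval σ [l₂, (B + 4 * i + 1, true), (B + 4 * i + 2, true)] = true ∧
        Clause.xeval σ [l₃.negate, (B + 4 * i + 2, true), (B + 4 * i + 3, true)] = true := by
      simpa [gadget, CNF.xeval] using h
    rw [xeval_triple, xeval_triple, xeval_triple, Literal.eval_negate, Literal.eval_negate,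
      eval_pos, eval_pos, eval_pos, eval_pos] at h'
    rw [← pad3_or_eq_eval σ hc hp]
    exact table_sound _ _ _ _ _ _ _ h'.1 h'.2.1 h'.2.2

/-- **Restriction**: if `reduce B φ` is one-in-three satisfiable then the width-`≤ 3` CNF `φ` is
satisfiable (by the same assignment). [cite: GareyJohnson1979, LO4 (p. 259)] -/
theorem satisfiable_of_xSatisfiable_reduce {B : ℕ} {φ : CNF ℕ} (hW : φ.IsWidthLE 3)
    (h : (reduce B φ).XSatisfiable) : φ.Satisfiable := by
  obtain ⟨σ, hσ⟩ := h
  refine ⟨σ, ?_⟩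
  have hall := (xeval_reduceFrom_iff B σ 0 φ).1 hσ
  unfold CNF.eval
  rw [List.all_eq_true]
  intro c hc
  obtain ⟨k, hk, rfl⟩ := List.getElem_of_mem hc
  exact eval_of_xeval_clauseGadget (hW _ (List.getElem_mem hk)) (by simpa using hall k hk)

/-! ### From a satisfying assignment of the input to a one-in-three assignment of the output -/

/-- The value given to the fresh variable `B + t` of the output: block `i = t / 4`, slot
`t % 4`, values `vals` of the slots of the `i`-th input clause under `σ`. [folklore] -/
def freshVal (σ : ℕ → Bool) (φ : CNF ℕ) (t : ℕ) : Bool :=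
  match φ[t / 4]? with
  | none => false
  | some c =>
    match pad3 c with
    | none => false
    | some (l₁, l₂, l₃) => vals (l₁.eval σ) (l₂.eval σ) (l₃.eval σ) (t % 4)

/-- **The extension** of an assignment of the input variables (`< B`) to the fresh variables.
[folklore] -/
def extend (B : ℕ) (σ : ℕ → Bool) (φ : CNF ℕ) (v : ℕ) : Bool :=
  if v < B then σ v else freshVal σ φ (v - B)

/-- The extension agrees with `σ` on literals of the input. [folklore] -/
theorem eval_extend_of_lt {B : ℕ} (σ : ℕ → Bool) (φ : CNF ℕ) {l : Literal ℕ} (hl : l.1 < B) :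
    l.eval (extend B σ φ) = l.eval σ := by
  simp [Literal.eval, extend, hl]

/-- The extension on the fresh variable of block `i`, slot `j < 4`. [folklore] -/
theorem extend_fresh {B : ℕ} (σ : ℕ → Bool) {φ : CNF ℕ} {i : ℕ} {c : Clause ℕ}
    (hi : φ[i]? = some c) {l₁ l₂ l₃ : Literal ℕ} (hp : pad3 c = some (l₁, l₂, l₃)) {j : ℕ}
    (hj : j < 4) :
    extend B σ φ (B + 4 * i + j) = vals (l₁.eval σ) (l₂.eval σ) (l₃.eval σ) j := by
  have hdiv : (4 * i + j) / 4 = i := by omega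
  have hmod : (4 * i + j) % 4 = j := by omega
  simp only [extend, show ¬ (B + 4 * i + j < B) from by omega, if_false,
    show B + 4 * i + j - B = 4 * i + j from by omega, freshVal, hdiv, hmod, hi, hp]

/-- A satisfying assignment of the input, extended, one-in-three satisfies every clause gadget.
[folklore] -/
theorem xeval_clauseGadget_extend {B : ℕ} {φ : CNF ℕ} (hW : φ.IsWidthLE 3)
    (hB : ∀ c ∈ φ, ∀ l ∈ c, l.1 < B) {σ : ℕ → Bool} (hσ : φ.eval σ = true) {i : ℕ}
    (hi : i < φ.length) : (clauseGadget B i (φ[i]'hi)).xeval (extend B σ φ) = true := by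
  have hcmem : φ[i]'hi ∈ φ := List.getElem_mem hi
  have hceval : Clause.eval σ (φ[i]'hi) = true := by
    unfold CNF.eval at hσ
    rw [List.all_eq_true] at hσ
    exact hσ _ hcmem
  unfold clauseGadget
  match hp : pad3 (φ[i]'hi) with
  | none =>
    exfalso
    have hnil := eq_nil_of_pad3_eq_none hp
    rw [hnil] at hceval
    simp [Clause.eval] at hceval
  | some (l₁, l₂, l₃) =>
    simp only
    obtain ⟨m₁, m₂, m₃⟩ := mem_of_pad3 hp
    have hor : (l₁.eval σ || l₂.eval σ || l₃.eval σ) = true := by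
      rw [pad3_or_eq_eval σ (hW _ hcmem) hp]; exact hceval
    obtain ⟨t₁, t₂, t₃⟩ := table_complete _ _ _ hor
    have hget : φ[i]? = some (φ[i]'hi) := List.getElem?_eq_getElem hi
    have e0 := extend_fresh (B := B) σ hget hp (j := 0) (by omega)
    have e1 := extend_fresh (B := B) σ hget hp (j := 1) (by omega)
    have e2 := extend_fresh (B := B) σ hget hp (j := 2) (by omega)
    have e3 := extend_fresh (B := B) σ hget hp (j := 3) (by omega)
    rw [Nat.add_zero] at e0
    have goal : Clause.xeval (extend B σ φ) [l₁.negate, (B + 4 * i, true), (B + 4 * i + 1, true)] = true ∧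
        Clause.xeval (extend B σ φ) [l₂, (B + 4 * i + 1, true), (B + 4 * i + 2, true)] = true ∧
        Clause.xeval (extend B σ φ) [l₃.negate, (B + 4 * i + 2, true), (B + 4 * i + 3, true)] = true := by
      rw [xeval_triple, xeval_triple, xeval_triple, Literal.eval_negate, Literal.eval_negate,
        eval_pos, eval_pos, eval_pos, eval_pos, e0, e1, e2, e3,
        eval_extend_of_lt σ φ (hB _ hcmem _ m₁), eval_extend_of_lt σ φ (hB _ hcmem _ m₂),
        eval_extend_of_lt σ φ (hB _ hcmem _ m₃)]
      exact ⟨t₁, t₂, t₃⟩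
    simpa [gadget, CNF.xeval] using goal

/-- **Extension**: a satisfying assignment of the width-`≤ 3` CNF `φ` (variables `< B`) extends
to a one-in-three assignment of `reduce B φ`. [cite: GareyJohnson1979, LO4 (p. 259)] -/
theorem xSatisfiable_reduce_of_satisfiable {B : ℕ} {φ : CNF ℕ} (hW : φ.IsWidthLE 3)
    (hB : ∀ c ∈ φ, ∀ l ∈ c, l.1 < B) (h : φ.Satisfiable) : (reduce B φ).XSatisfiable := by
  obtain ⟨σ, hσ⟩ := h
  refine ⟨extend B σ φ, (xeval_reduceFrom_iff B _ 0 φ).2 fun k hk => ?_⟩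
  simpa using xeval_clauseGadget_extend hW hB hσ hk

/-- **Correctness of the transformation**: for a CNF of width `≤ 3` whose variables lie below
`B`, `reduce B φ` is one-in-three satisfiable iff `φ` is satisfiable.
[cite: GareyJohnson1979, LO4 (p. 259)] -/
theorem xSatisfiable_reduce_iff {B : ℕ} {φ : CNF ℕ} (hW : φ.IsWidthLE 3)
    (hB : ∀ c ∈ φ, ∀ l ∈ c, l.1 < B) : (reduce B φ).XSatisfiable ↔ φ.Satisfiable :=
  ⟨satisfiable_of_xSatisfiable_reduce hW, xSatisfiable_reduce_of_satisfiable hW hB⟩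

/-- The transformation lands in the instance class of ONE-IN-THREE 3SAT and preserves the
answer: the formula-level statement behind `kSAT 3 ≤ₚ ONEIN3SAT`. [cite: GareyJohnson1979, LO4 (p. 259)] -/
theorem reduce_mem_iff {B : ℕ} {φ : CNF ℕ} (hW : φ.IsWidthLE 3)
    (hB : ∀ c ∈ φ, ∀ l ∈ c, l.1 < B) :
    encodingCNF.encode (reduce B φ) ∈ ONEIN3SAT ↔ φ.Satisfiable := by
  rw [mem_ONEIN3SAT_iff]
  exact ⟨fun h => (xSatisfiable_reduce_iff hW hB).1 h.2,
    fun h => ⟨isThreeLiteralClauses_reduce hB, (xSatisfiable_reduce_iff hW hB).2 h⟩⟩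

end OneInThree

end Literature.Computability.Complexity
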